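import Mathlib
import HarnessLib
import Literature.Computability.AlgebraicComplexity.LaserMethodValues
import Literature.Computability.AlgebraicComplexity.LaserSymmetrization
import Literature.Computability.AlgebraicComplexity.FlatteningBound
import Literature.Barriers.MatrixMultiplication.IrreversibilityBarrierProofs
import Literature.Barriers.MatrixMultiplication.UniversalMethodBarrierProducts

/-!
# OutsiderSandwich — Strassen's lower bound for the asymptotic subrank of a tensor with tight support (decomp-mm lens-4, g17)

The SUBRANK form of the laser method with trivial blocking (every basis vector its own block),
i.e. Strassen's theorem `Q̃(t) ≥ 2^{min_m H(P_m)}` for a probability distribution `P` on the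
tight support of `t` (V. Strassen, J. reine angew. Math. 413 (1991); Christandl–Vrana–Zuiddam,
arXiv:1709.07851, Thm. 4.4), here with Le Gall's penalty term and for rational `P`:

* `le_asymptoticSubrank_of_tight` — if `S = supp t` is `b`-tight (injective integer labellings
  `α, β, γ` with `α + β + γ = 0` on `S`) and `P = c/d` is a rational probability distribution on `S`,
  then `2^{min_m H(P_m) − Γ_S(P)} ≤ Q̃(t)`.  Proof: the tree's free diagonal of one joint type
  (`exists_free_diagonal_jointType_card`: `2^{N(min H − Γ)} ≤ |Δ| · J(N)` with `J` subexponential,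
  `exists_errTerm_le_mul`) is a restriction `t^{⊗N} ≥ ⟨|Δ|⟩ ⊗ t^{⊗N}(w₀)`
  (`tensorRestrictsTo_kroneckerPow_multiple_laserBlock`); with singleton blocks the block
  `t^{⊗N}(w₀)` is a non-zero scalar entry, `≥ ⟨1⟩`, so `Q(t^{⊗N}) ≥ |Δ|`, and
  `Q̃(t) ≥ Q(t^{⊗N})^{1/N}` (`rpow_inv_subrank_le_asymptoticSubrank`).
* `rotate_unitTensor`, `TensorRestrictsTo` under rotation is the tree's `TensorRestrictsTo.rotate`.

Used by `Theorems/OutsiderSandwichBlockSubrank.lean` (`Q̃(C₁) ≥ 4` for the coupled CW block).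
-/

noncomputable section

namespace Summit.MatrixMultiplication.MatrixMultiplication.Theorems.OutsiderSandwichTightSubrank

open Literature.Computability.AlgebraicComplexity
open Literature.Barriers.MatrixMultiplication (le_subrank_of_restrictsTo
  restrictsTo_unitTensor_iff_le_subrank one_le_subrank_of_ne_zero subrank_kroneckerPow_le_card_pow
  tensorRestrictsTo_unitTensor_mul)

/-! ## 1. `Q̃(t) ≥ Q(t^{⊗N})^{1/N}` -/

/-- The sequence defining `Q̃` is bounded by `|ι|`. -/
theorem bddAbove_subrank_seq {ι κ μ : Type} [Fintype ι] [Fintype κ] [Fintype μ]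
    (t : ι → κ → μ → ℂ) :
    BddAbove (Set.range fun n : ℕ =>
      ((subrank ℂ (kroneckerPow t (n + 1)) : ℝ)) ^ (((n : ℝ) + 1)⁻¹)) := by
  classical
  refine ⟨Fintype.card ι, ?_⟩
  rintro _ ⟨m, rfl⟩
  dsimp only
  have hq : ((subrank ℂ (kroneckerPow t (m + 1)) : ℝ)) ≤ (Fintype.card ι : ℝ) ^ (m + 1) := by
    exact_mod_cast subrank_kroneckerPow_le_card_pow t (m + 1)
  have hm : (0 : ℝ) ≤ ((m : ℝ) + 1)⁻¹ := by positivity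
  calc ((subrank ℂ (kroneckerPow t (m + 1)) : ℝ)) ^ (((m : ℝ) + 1)⁻¹)
      ≤ ((Fintype.card ι : ℝ) ^ (m + 1)) ^ (((m : ℝ) + 1)⁻¹) :=
        Real.rpow_le_rpow (Nat.cast_nonneg _) hq hm
    _ = Fintype.card ι := by
        rw [← Nat.cast_succ, Real.pow_rpow_inv_natCast (Nat.cast_nonneg _) (Nat.succ_ne_zero m)]

/-- **`Q(t^{⊗N})^{1/N} ≤ Q̃(t)`** for `N ≥ 1` (`Q̃` is the supremum). -/
theorem rpow_inv_subrank_le_asymptoticSubrank {ι κ μ : Type} [Fintype ι] [Fintype κ] [Fintype μ]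
    (t : ι → κ → μ → ℂ) {N : ℕ} (hN : 0 < N) :
    ((subrank ℂ (kroneckerPow t N) : ℝ)) ^ ((N : ℝ)⁻¹) ≤ asymptoticSubrank ℂ t := by
  classical
  obtain ⟨n, rfl⟩ : ∃ n, N = n + 1 := ⟨N - 1, by omega⟩
  have h := le_ciSup (bddAbove_subrank_seq t) n
  unfold asymptoticSubrank
  push_cast
  exact h

/-- `0 ≤ Q̃(t)`. -/
theorem asymptoticSubrank_nonneg {ι κ μ : Type} [Fintype ι] [Fintype κ] [Fintype μ]
    (t : ι → κ → μ → ℂ) : 0 ≤ asymptoticSubrank ℂ t := by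
  unfold asymptoticSubrank
  exact Real.iSup_nonneg fun n => Real.rpow_nonneg (Nat.cast_nonneg _) _

/-! ## 2. Singleton blocks are scalars -/

/-- With singleton blocks, the block of `t^{⊗N}` at a word of support letters is non-zero. -/
theorem laserBlock_id_ne_zero {ι κ μ : Type} [Fintype ι] [Fintype κ] [Fintype μ] [DecidableEq ι]
    [DecidableEq κ] [DecidableEq μ] (t : ι → κ → μ → ℂ) {N : ℕ} (w : Fin N → ι × κ × μ)
    (hw : ∀ q, t (w q).1 (w q).2.1 (w q).2.2 ≠ 0) :
    laserBlock id id id t w ≠ 0 := by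
  intro h0
  have h := congrFun (congrFun (congrFun h0 (fun q => (w q).1)) (fun q => (w q).2.1))
    (fun q => (w q).2.2)
  rw [laserBlock_apply, if_pos (fun q => ⟨rfl, rfl, rfl⟩), kroneckerPow_apply] at h
  simp only [Pi.zero_apply] at h
  exact Finset.prod_ne_zero_iff.2 (fun q _ => hw q) h

/-- Hence such a block restricts to `⟨1⟩`. -/
theorem laserBlock_id_restrictsTo_unit {ι κ μ : Type} [Fintype ι] [Fintype κ] [Fintype μ]
    [DecidableEq ι] [DecidableEq κ] [DecidableEq μ] (t : ι → κ → μ → ℂ) {N : ℕ}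
    (w : Fin N → ι × κ × μ) (hw : ∀ q, t (w q).1 (w q).2.1 (w q).2.2 ≠ 0) :
    TensorRestrictsTo (laserBlock id id id t w) (unitTensor ℂ 1) :=
  (restrictsTo_unitTensor_iff_le_subrank _ 1).2
    (one_le_subrank_of_ne_zero (laserBlock_id_ne_zero t w hw))

/-! ## 3. Strassen's lower bound for tight supports -/

/-- **`Q̃(t) ≥ 2^{min_m H(P_m) − Γ_S(P)}`** for the (exact, `b`-tight) support `S` of `t` and a
rational probability distribution `P = c/d` on `S` (Strassen 1991 / CVZ Thm. 4.4, in Le Gall's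
form with the penalty `Γ_S = maxEntropyPenalty S`; the laser method with singleton blocks, read
for the subrank). -/
theorem le_asymptoticSubrank_of_tight {ι κ μ : Type} [Fintype ι] [Fintype κ] [Fintype μ]
    [DecidableEq ι] [DecidableEq κ] [DecidableEq μ] (t : ι → κ → μ → ℂ) (S : Finset (ι × κ × μ))
    (hS : ∀ a b c, t a b c ≠ 0 → (a, b, c) ∈ S) (hSt : ∀ s ∈ S, t s.1 s.2.1 s.2.2 ≠ 0)
    {r b : ℕ} (α : ι → Fin r → ℤ) (β : κ → Fin r → ℤ) (γ : μ → Fin r → ℤ)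
    (hα : Function.Injective α) (hβ : Function.Injective β) (hγ : Function.Injective γ)
    (hαb : ∀ i k, |α i k| ≤ b) (hβb : ∀ j k, |β j k| ≤ b)
    (htight : ∀ s ∈ S, ∀ k, α s.1 k + β s.2.1 k + γ s.2.2 k = 0)
    (c : ι × κ × μ → ℕ) (hcS : ∀ s, s ∉ S → c s = 0) {d : ℕ} (hd : 0 < d) (hc : ∑ s, c s = d)
    (P : ι × κ × μ → ℝ) (hP : ∀ s, P s = (c s : ℝ) / d) :
    (2 : ℝ) ^ (min (shannonEntropy (marginalDist₁ P))
        (min (shannonEntropy (marginalDist₂ P)) (shannonEntropy (marginalDist₃ P))) -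
        maxEntropyPenalty S P) ≤ asymptoticSubrank ℂ t := by
  classical
  -- notation
  set E : ℝ := min (shannonEntropy (marginalDist₁ P))
      (min (shannonEntropy (marginalDist₂ P)) (shannonEntropy (marginalDist₃ P))) -
    maxEntropyPenalty S P with hE
  have h2E : 0 < (2 : ℝ) ^ E := Real.rpow_pos_of_pos two_pos _
  -- it suffices to show `v' ≤ Q̃(t)` for every `0 < v' < 2^E`
  by_contra hlt
  push Not at hlt
  have hQ0 := asymptoticSubrank_nonneg t
  set v' : ℝ := (asymptoticSubrank ℂ t + (2 : ℝ) ^ E) / 2 with hv'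
  have hv'pos : 0 < v' := by rw [hv']; linarith
  have hv'lt : v' < (2 : ℝ) ^ E := by rw [hv']; linarith
  have hQv' : asymptoticSubrank ℂ t < v' := by rw [hv']; linarith
  suffices hmain : v' ≤ asymptoticSubrank ℂ t from absurd hmain (not_le.2 hQv')
  -- `θ = 2^E / v' > 1`
  set θ : ℝ := (2 : ℝ) ^ E / v' with hθ
  have hθ1 : 1 < θ := (one_lt_div hv'pos).2 hv'lt
  have hθ0 : 0 < θ := one_pos.trans hθ1
  have hlogθ : 0 < Real.log θ := Real.log_pos hθ1
  -- constants of the counting bound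
  set G : ℕ := Fintype.card (ι × κ × μ) with hG
  set A : ℕ := Fintype.card ι + Fintype.card κ + Fintype.card μ with hA
  set b' : ℕ := max b 1 with hb'
  have hu : 0 ≤ Real.log ((3 * b' : ℕ) : ℝ) := Real.log_natCast_nonneg _
  have hlogG : 0 ≤ Real.log (G : ℝ) := Real.log_natCast_nonneg _
  obtain ⟨M, hM1, hM⟩ := exists_errTerm_le_mul (a := ((2 * G + A : ℕ) : ℝ)) (e := 4)
    (w := Real.log (96 * (b' : ℝ))) (Nat.cast_nonneg _) (by norm_num) hu hlogG hlogθ hd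
  have hM0 : 0 < M := by omega
  -- the power `N = d M` and the count vector `Q = M c`
  obtain ⟨N, hN⟩ : ∃ N : ℕ, N = d * M := ⟨_, rfl⟩
  rw [← hN] at hM
  have hN0 : 0 < N := hN ▸ Nat.mul_pos hd hM0
  set Q : ι × κ × μ → ℕ := fun s => M * c s with hQ
  have hQS : ∀ s, s ∉ S → Q s = 0 := fun s hs => by simp [hQ, hcS s hs]
  have hQsum : ∑ s, Q s = N := by
    simp only [hQ]; rw [← Finset.mul_sum, hc, hN, mul_comm]
  have hPQ : ∀ s, P s = (Q s : ℝ) / N := by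
    intro s
    rw [hP, hQ, hN]
    push_cast
    have hd0 : (d : ℝ) ≠ 0 := by exact_mod_cast hd.ne'
    have hM0' : (M : ℝ) ≠ 0 := by exact_mod_cast hM0.ne'
    field_simp
  -- the free diagonal of type `Q`
  obtain ⟨Δ, hΔQ, hfree, hcount⟩ := exists_free_diagonal_jointType_card S α β γ hα hβ hγ hαb hβb
    htight hN0 Q hQS hQsum P hPQ
  rw [← hE] at hcount
  -- the junk factor is `≤ θ^N`
  set Jf : ℝ := ((N : ℝ) + 1) ^ (2 * Fintype.card (ι × κ × μ) +
      (Fintype.card ι + Fintype.card κ + Fintype.card μ)) * (96 * ((max b 1 : ℕ) : ℝ)) *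
    Real.exp (4 * √(Real.log ((3 * max b 1 : ℕ) : ℝ) +
      (N : ℝ) * Real.log (Fintype.card (ι × κ × μ) : ℝ))) with hJf
  have hJpos : 0 < Jf := by positivity
  have hJθ : Jf ≤ θ ^ N := by
    rw [← Real.exp_log hJpos, ← Real.exp_log (pow_pos hθ0 N), Real.exp_le_exp, Real.log_pow]
    have hlogJ : Real.log Jf = ((2 * G + A : ℕ) : ℝ) * Real.log ((N : ℝ) + 1) +
        Real.log (96 * (b' : ℝ)) +
        4 * √(Real.log ((3 * b' : ℕ) : ℝ) + (N : ℝ) * Real.log (G : ℝ)) := by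
      rw [hJf, Real.log_mul (by positivity) (by positivity),
        Real.log_mul (by positivity) (by positivity), Real.log_exp, Real.log_pow, hG, hA, hb']
    rw [hlogJ, show (N : ℝ) * Real.log (G : ℝ) = Real.log (G : ℝ) * N from mul_comm _ _]
    linarith [hM]
  -- a word of type `Q`; all its letters lie in `S`, so the block `t^{⊗N}(w₀)` is a non-zero scalar
  obtain ⟨w₀, hw₀⟩ := typeClass_nonempty N Q hQsum
  rw [mem_typeClass] at hw₀
  have hw0t : ∀ q, t (w₀ q).1 (w₀ q).2.1 (w₀ q).2.2 ≠ 0 := by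
    intro q
    apply hSt
    by_contra hq
    have h1 : 1 ≤ letterCount w₀ (w₀ q) := by
      rw [letterCount_apply]
      exact Finset.card_pos.2 ⟨q, Finset.mem_filter.2 ⟨Finset.mem_univ _, rfl⟩⟩
    rw [hw₀] at h1
    have : Q (w₀ q) = 0 := hQS _ hq
    omega
  -- `t^{⊗N} ≥ ⟨|Δ|⟩ ⊗ t^{⊗N}(w₀) ≥ ⟨|Δ|⟩ ⊗ ⟨1⟩ ≥ ⟨|Δ|⟩`
  have hres := tensorRestrictsTo_kroneckerPow_multiple_laserBlock t id id id S
    (fun a b c h => hS a b c h) Δ hfree w₀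
    (fun δ hδ => by rw [hw₀]; exact (Finset.mem_filter.1 (hΔQ hδ)).2)
  have hdiag : TensorRestrictsTo (kroneckerPow t N) (unitTensor ℂ (Δ.card * 1)) :=
    (hres.trans ((TensorRestrictsTo.refl _).kronecker (laserBlock_id_restrictsTo_unit t w₀ hw0t))).trans
      (tensorRestrictsTo_unitTensor_mul ℂ Δ.card 1)
  rw [mul_one] at hdiag
  have hQN : (Δ.card : ℝ) ≤ subrank ℂ (kroneckerPow t N) := by
    exact_mod_cast le_subrank_of_restrictsTo hdiag
  -- `v'^N ≤ |Δ|` because `v'^N θ^N = 2^{N E} ≤ |Δ| J ≤ |Δ| θ^N`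
  have hvθ : v' * θ = (2 : ℝ) ^ E := by
    rw [hθ]; field_simp
  have h2EN : ((2 : ℝ) ^ E) ^ N = (2 : ℝ) ^ ((N : ℝ) * E) := by
    rw [← Real.rpow_natCast ((2 : ℝ) ^ E) N, ← Real.rpow_mul zero_le_two, mul_comm]
  have key : v' ^ N ≤ Δ.card := by
    have h1 : v' ^ N * θ ^ N ≤ (Δ.card : ℝ) * θ ^ N :=
      calc v' ^ N * θ ^ N = (v' * θ) ^ N := (mul_pow _ _ _).symm
        _ = (2 : ℝ) ^ ((N : ℝ) * E) := by rw [hvθ, h2EN]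
        _ ≤ Δ.card * Jf := hcount
        _ ≤ Δ.card * θ ^ N := by gcongr
    exact le_of_mul_le_mul_right h1 (pow_pos hθ0 N)
  calc v' = (v' ^ N) ^ ((N : ℝ)⁻¹) := (Real.pow_rpow_inv_natCast hv'pos.le hN0.ne').symm
    _ ≤ ((subrank ℂ (kroneckerPow t N) : ℕ) : ℝ) ^ ((N : ℝ)⁻¹) :=
        Real.rpow_le_rpow (pow_nonneg hv'pos.le N) (key.trans hQN) (inv_nonneg.2 (Nat.cast_nonneg N))
    _ ≤ asymptoticSubrank ℂ t := rpow_inv_subrank_le_asymptoticSubrank t hN0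

/-! ## 4. Rotation -/

/-- The unit tensor is rotation invariant. -/
theorem rotate_unitTensor (n : ℕ) : rotate (unitTensor ℂ n) = unitTensor ℂ n := by
  funext b c a
  simp only [rotate_apply, unitTensor_apply]
  exact if_congr ⟨fun ⟨h1, h2⟩ => ⟨h2, (h1.trans h2).symm⟩, fun ⟨h1, h2⟩ => ⟨(h1.trans h2).symm, h1⟩⟩
    rfl rfl

/-- Powers commute with rotation (definitionally). -/
theorem rotate_kroneckerPow {ι κ μ : Type} (t : ι → κ → μ → ℂ) (N : ℕ) :
    rotate (kroneckerPow t N) = kroneckerPow (rotate t) N := by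
  funext b c a
  rfl

/-- **Diagonals survive rotation**: `t^{⊗N} ≥ ⟨r⟩ ⟹ (t_C)^{⊗N} ≥ ⟨r⟩`. -/
theorem restrictsTo_unitTensor_kroneckerPow_rotate {ι κ μ : Type} [Fintype ι] [Fintype κ]
    [Fintype μ] (t : ι → κ → μ → ℂ) {N r : ℕ}
    (h : TensorRestrictsTo (kroneckerPow t N) (unitTensor ℂ r)) :
    TensorRestrictsTo (kroneckerPow (rotate t) N) (unitTensor ℂ r) := by
  rw [← rotate_kroneckerPow, ← rotate_unitTensor r]
  exact h.rotate

end Summit.MatrixMultiplication.MatrixMultiplication.Theorems.OutsiderSandwichTightSubrank
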